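import Mathlib.NumberTheory.NumberField.Basic
import Mathlib.RingTheory.DedekindDomain.AdicValuation
import Mathlib.RingTheory.Ideal.Norm.AbsNorm
import Mathlib.RingTheory.PrincipalIdealDomain
import HarnessLib

/-!
# `K(S, 2)` for a class-number-one number field, by unique factorisation

Topic `NumberTheory/NumberFields`. For a number field `K` whose ring of integers is a principal
ideal domain (hence a UFD), the group
`K(S, 2) = {b ∈ Kˣ/Kˣ² : ord_v(b) ≡ 0 (mod 2) for all v ∉ S}` (Silverman, *AEC*, Thm. X.1.1(c),
Prop. VIII.1.6) is spanned by the units and the prime elements above `S`: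

* `exists_isSquare_mul_of_two_dvd_log_valuation` (namespace `Literature.NumberTheory.NumberFields`):
  let `D ∈ 𝓞 K` and `G` a list of elements such that every prime element dividing `D` is
  associated to a member of `G`
  (the primes above `S = {v : D ∈ v}`). If `b ∈ Kˣ` has `ord_v(b)` even for every finite place
  `v` with `D ∉ v`, then `b · u · ∏_{g ∈ l} g` is a square in `K` for some unit `u ∈ (𝓞 K)ˣ` and
  some duplicate-free sublist `l` of `G`.

This is the `S`-enlargement-free form of "`R_S` principal ⟹ `K(S,2) ≅ R_Sˣ/R_Sˣ²`" (AEC, proof of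
Prop. VIII.1.6) for `h_K = 1`, proved directly by induction on the norm: clear denominators,
peel off prime factors of `b ∈ 𝓞 K` — a prime `q ∤ D` occurs to an even power (`ord_q(b)` even,
`IsDedekindDomain.HeightOneSpectrum.intValuation_le_pow_iff_mem`), a prime `q ∣ D` is a unit
times some `g ∈ G` — until a unit remains. Combined with an explicit set of representatives of
`(𝓞 K)ˣ/((𝓞 K)ˣ)²` (Dirichlet) it makes `K(S, 2)` completely explicit, which is what an explicit
`2`-descent over `K` needs (written for the cubic fields of
`Literature/Barriers/BirchSwinnertonDyer/RankNotSumOfLocalInvariantsF3Cubic*.lean`). Theorems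
and one small definition (`placeOfPrime`, the finite place of a prime element), in the topic
namespace `Literature.NumberTheory.NumberFields`.

## References

* J. H. Silverman, *The Arithmetic of Elliptic Curves*, 2nd ed., GTM 106 (2009), Prop. VIII.1.6
  (proof) and Thm. X.1.1(c). [SilvermanAEC2009]
-/

noncomputable section

open scoped NumberField
open IsDedekindDomain IsDedekindDomain.HeightOneSpectrum Ideal

namespace Literature.NumberTheory.NumberFields

variable {K : Type*} [Field K] [NumberField K]

/-- For a prime element `q` of `𝓞 K`, the finite place `(q)`. [folklore] -/
def placeOfPrime {q : 𝓞 K} (hq : Prime q) : HeightOneSpectrum (𝓞 K) :=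
  ⟨span {q}, (span_singleton_prime hq.ne_zero).mpr hq, by
    rw [Ne, span_singleton_eq_bot]; exact hq.ne_zero⟩

/-- `ord_{(q)}(a) ≤ -2`, i.e. `(q)² ∣ (a)`, from `q ∣ a` and `ord_{(q)}(a)` even (`a ≠ 0`): the
valuation is `exp(-n)` with `n ≥ 1` even. [folklore] -/
theorem sq_dvd_of_prime_dvd_of_two_dvd_log {q a : 𝓞 K} (hq : Prime q) (ha : a ≠ 0)
    (hqa : q ∣ a)
    (h2 : (2 : ℤ) ∣ WithZero.log ((placeOfPrime hq).valuation K (a : K))) : q ^ 2 ∣ a := by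
  set v := placeOfPrime hq with hv
  rw [valuation_of_algebraMap] at h2
  have hlt : v.intValuation a < 1 := (intValuation_lt_one_iff_dvd v a).mpr (by
    rw [hv, placeOfPrime, dvd_span_singleton]; exact mem_span_singleton.mpr hqa)
  have hne : v.intValuation a ≠ 0 := intValuation_ne_zero v a ha
  -- write the valuation as `exp (log)`
  set n := WithZero.log (v.intValuation a) with hn
  have hexp : v.intValuation a = WithZero.exp n := (WithZero.exp_log hne).symm
  have hn0 : n < 0 := by
    have : WithZero.exp n < WithZero.exp 0 := by rw [← hexp, WithZero.exp_zero]; exact hlt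
    exact WithZero.exp_lt_exp.mp this
  obtain ⟨k, hk⟩ := h2
  have hle : v.intValuation a ≤ WithZero.exp (-(2 : ℕ) : ℤ) := by
    rw [hexp, WithZero.exp_le_exp]
    omega
  have hmem := (intValuation_le_pow_iff_mem v a 2).mp hle
  rw [hv, placeOfPrime] at hmem
  change a ∈ span {q} ^ 2 at hmem
  rw [span_singleton_pow, mem_span_singleton] at hmem
  exact hmem

/-- The valuation of a product of non-zero elements is even iff the parities of the factors
agree (`log` is additive). [folklore] -/
theorem two_dvd_log_valuation_mul_iff (v : HeightOneSpectrum (𝓞 K)) {x y : K} (hx : x ≠ 0)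
    (hy : y ≠ 0) (h : (2 : ℤ) ∣ WithZero.log (v.valuation K y)) :
    (2 : ℤ) ∣ WithZero.log (v.valuation K (x * y)) ↔
      (2 : ℤ) ∣ WithZero.log (v.valuation K x) := by
  rw [map_mul, WithZero.log_mul ((v.valuation K).ne_zero_iff.mpr hx)
    ((v.valuation K).ne_zero_iff.mpr hy)]
  exact ⟨fun h' => (Int.dvd_add_left h).mp h', fun h' => dvd_add h' h⟩

/-- An element of `𝓞 K` outside `v` has `ord_v = 0`. [folklore] -/
theorem log_valuation_eq_zero_of_not_mem (v : HeightOneSpectrum (𝓞 K)) {g : 𝓞 K}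
    (hg : g ∉ v.asIdeal) : WithZero.log (v.valuation K (g : K)) = 0 := by
  rw [valuation_of_algebraMap, intValuation_eq_one_iff.mpr hg, WithZero.log_one]

/-- **The integral case.** `𝓞 K` a PID, `D ∈ 𝓞 K`, `G` a list such that every prime
dividing `D` is associated to a member of `G` (the prime elements above `S`): every non-zero `a ∈ 𝓞 K` with `ord_v(a)` even
for all `v ∌ D` is a unit times a duplicate-free product of members of `G` times a square.
(Induction on the ideal norm.) [cite: SilvermanAEC2009, Prop. VIII.1.6 (proof)] -/
theorem exists_isSquare_mul_of_two_dvd_log_valuation_int [IsPrincipalIdealRing (𝓞 K)]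
    (D : 𝓞 K) (G : List (𝓞 K))
    (hD : ∀ q : 𝓞 K, Prime q → q ∣ D → ∃ g ∈ G, Associated q g) :
    ∀ (a : 𝓞 K), a ≠ 0 →
      (∀ v : HeightOneSpectrum (𝓞 K), D ∉ v.asIdeal →
        (2 : ℤ) ∣ WithZero.log (v.valuation K (a : K))) →
      ∃ (u : (𝓞 K)ˣ) (l : List (𝓞 K)), (∀ g ∈ l, g ∈ G) ∧ l.Nodup ∧
        IsSquare ((a : K) * (u : 𝓞 K) * (l.prod : 𝓞 K)) := by
  -- strong induction on the ideal norm
  suffices key : ∀ (n : ℕ) (a : 𝓞 K), absNorm (span {a}) = n → a ≠ 0 →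
      (∀ v : HeightOneSpectrum (𝓞 K), D ∉ v.asIdeal →
        (2 : ℤ) ∣ WithZero.log (v.valuation K (a : K))) →
      ∃ (u : (𝓞 K)ˣ) (l : List (𝓞 K)), (∀ g ∈ l, g ∈ G) ∧ l.Nodup ∧
        IsSquare ((a : K) * (u : 𝓞 K) * (l.prod : 𝓞 K)) from
    fun a ha hval => key _ a rfl ha hval
  intro n
  induction n using Nat.strong_induction_on with
  | _ n ih =>
  classical
  intro a han ha hval
  by_cases hu : IsUnit a
  · -- a unit: `a · a⁻¹ = 1`
    refine ⟨hu.unit⁻¹, [], by simp, List.nodup_nil, 1, ?_⟩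
    have h1 := congrArg (fun z : 𝓞 K => (z : K)) hu.mul_val_inv
    push_cast at h1
    rw [List.prod_nil]
    push_cast
    rw [h1]
  · -- a prime factor `q` of `a`
    obtain ⟨q, hqirr, hqa⟩ := WfDvdMonoid.exists_irreducible_factor hu ha
    have hq : Prime q := UniqueFactorizationMonoid.irreducible_iff_prime.mp hqirr
    have hq0 : q ≠ 0 := hq.ne_zero
    have hnormq : 1 < absNorm (span {q}) := by
      rcases Nat.lt_or_ge 1 (absNorm (span {q})) with h | h
      · exact h
      · exfalso
        interval_cases h' : absNorm (span ({q} : Set (𝓞 K)))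
        · exact hq0 (span_singleton_eq_bot.mp (absNorm_eq_zero_iff.mp h'))
        · exact hq.not_unit (span_singleton_eq_top.mp (absNorm_eq_one_iff.mp h'))
    by_cases hqD : q ∣ D
    · -- `q ∣ D`: `q ~ g ∈ G`, `a = g a₁`
      obtain ⟨g, hgG, hqg⟩ := hD q hq hqD
      have hga : g ∣ a := hqg.symm.dvd.trans hqa
      obtain ⟨a₁, rfl⟩ := hga
      have ha₁ : a₁ ≠ 0 := right_ne_zero_of_mul ha
      have hg0 : g ≠ 0 := left_ne_zero_of_mul ha
      have hgD : g ∣ D := hqg.symm.dvd.trans hqD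
      -- the norm drops
      have hlt : absNorm (span {a₁}) < n := by
        rw [← han, ← span_singleton_mul_span_singleton, map_mul]
        have h1 : 1 < absNorm (span {g}) := by
          rw [span_singleton_eq_span_singleton.mpr hqg.symm]; exact hnormq
        have h2 : 0 < absNorm (span {a₁}) := Nat.pos_of_ne_zero fun h =>
          ha₁ (span_singleton_eq_bot.mp (absNorm_eq_zero_iff.mp h))
        nlinarith
      -- the parity hypothesis for `a₁`
      have hval₁ : ∀ v : HeightOneSpectrum (𝓞 K), D ∉ v.asIdeal →
          (2 : ℤ) ∣ WithZero.log (v.valuation K (a₁ : K)) := by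
        intro v hv
        have hgv : g ∉ v.asIdeal := fun h => hv (Ideal.mem_of_dvd _ hgD |> fun f => f h)
        have h := hval v hv
        push_cast at h
        rw [mul_comm] at h
        exact (two_dvd_log_valuation_mul_iff v (by exact_mod_cast ha₁) (by exact_mod_cast hg0)
          (by rw [log_valuation_eq_zero_of_not_mem v hgv]; exact dvd_zero 2)).mp h
      obtain ⟨u, l, hlG, hnd, hsq⟩ := ih _ hlt a₁ rfl ha₁ hval₁
      by_cases hgl : g ∈ l
      · refine ⟨u, l.erase g, fun x hx => hlG x (List.mem_of_mem_erase hx), hnd.erase g, ?_⟩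
        have hprod : (l.prod : 𝓞 K) = g * (l.erase g).prod := (List.prod_erase hgl).symm
        rw [hprod] at hsq
        push_cast at hsq ⊢
        convert hsq using 1
        ring
      · refine ⟨u, g :: l, ?_, List.nodup_cons.mpr ⟨hgl, hnd⟩, ?_⟩
        · intro x hx
          rcases List.mem_cons.mp hx with rfl | hx
          · exact hgG
          · exact hlG x hx
        · obtain ⟨w, hw⟩ := hsq
          refine ⟨(g : K) * w, ?_⟩
          rw [List.prod_cons]
          push_cast at hw ⊢
          linear_combination (g : K) ^ 2 * hw
    · -- `q ∤ D`: `q² ∣ a`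
      set v := placeOfPrime hq with hvdef
      have hDv : D ∉ v.asIdeal := by
        change D ∉ span {q}
        rw [mem_span_singleton]; exact hqD
      have hq2 : q ^ 2 ∣ a := sq_dvd_of_prime_dvd_of_two_dvd_log hq ha hqa (hval v hDv)
      obtain ⟨a₁, rfl⟩ := hq2
      have ha₁ : a₁ ≠ 0 := right_ne_zero_of_mul ha
      have hlt : absNorm (span {a₁}) < n := by
        rw [← han, ← span_singleton_mul_span_singleton, map_mul, ← span_singleton_pow,
          map_pow]
        have h2 : 0 < absNorm (span {a₁}) := Nat.pos_of_ne_zero fun h =>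
          ha₁ (span_singleton_eq_bot.mp (absNorm_eq_zero_iff.mp h))
        have h3 : 1 < absNorm (span {q}) ^ 2 := by nlinarith
        calc absNorm (span {a₁}) = 1 * absNorm (span {a₁}) := (one_mul _).symm
          _ < absNorm (span {q}) ^ 2 * absNorm (span {a₁}) := Nat.mul_lt_mul_of_pos_right h3 h2
      have hval₁ : ∀ v : HeightOneSpectrum (𝓞 K), D ∉ v.asIdeal →
          (2 : ℤ) ∣ WithZero.log (v.valuation K (a₁ : K)) := by
        intro v' hv'
        have h := hval v' hv'
        push_cast at h
        rw [mul_comm] at h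
        have hq0' : ((q : K) ^ 2) ≠ 0 := pow_ne_zero 2 (by exact_mod_cast hq0)
        refine (two_dvd_log_valuation_mul_iff v' (by exact_mod_cast ha₁) hq0' ?_).mp h
        rw [map_pow, WithZero.log_pow]
        exact ⟨_, by rw [two_nsmul, two_mul]⟩
      obtain ⟨u, l, hlG, hnd, hsq⟩ := ih _ hlt a₁ rfl ha₁ hval₁
      refine ⟨u, l, hlG, hnd, ?_⟩
      obtain ⟨w, hw⟩ := hsq
      refine ⟨(q : K) * w, ?_⟩
      push_cast at hw ⊢
      linear_combination (q : K) ^ 2 * hw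

/-- **`K(S, 2)` is spanned by units and the primes above `S` when `h_K = 1`.** Let `𝓞 K` be a
PID, `D ∈ 𝓞 K`, and `G` a list (of prime elements, in practice) such that every prime
element dividing `D` is associated to a member of `G`. If `b ∈ Kˣ` has `ord_v(b) ≡ 0 (mod 2)` for every finite place
`v` with `D ∉ v` (i.e. `b̄ ∈ K(S, 2)` for `S` the places dividing `D`), then for some unit
`u ∈ (𝓞 K)ˣ` and some duplicate-free sublist `l` of `G` the element `b · u · ∏ l` is a square in
`K`. (Silverman, proof of Prop. VIII.1.6: "`R_S` is a principal ideal domain … every `b`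
representing an element of `T_S` … is an `S`-unit times a square", here for `h_K = 1` without
enlarging `S`.) [cite: SilvermanAEC2009, Prop. VIII.1.6 (proof)] -/
theorem exists_isSquare_mul_of_two_dvd_log_valuation [IsPrincipalIdealRing (𝓞 K)]
    (D : 𝓞 K) (G : List (𝓞 K))
    (hD : ∀ q : 𝓞 K, Prime q → q ∣ D → ∃ g ∈ G, Associated q g)
    {b : K} (hb : b ≠ 0)
    (hval : ∀ v : HeightOneSpectrum (𝓞 K), D ∉ v.asIdeal →
      (2 : ℤ) ∣ WithZero.log (v.valuation K b)) :
    ∃ (u : (𝓞 K)ˣ) (l : List (𝓞 K)), (∀ g ∈ l, g ∈ G) ∧ l.Nodup ∧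
      IsSquare (b * (u : 𝓞 K) * (l.prod : 𝓞 K)) := by
  obtain ⟨x, y, hy, hxy⟩ := IsFractionRing.div_surjective (A := 𝓞 K) b
  have hy0 : y ≠ 0 := nonZeroDivisors.ne_zero hy
  have hy0' : (y : K) ≠ 0 := by exact_mod_cast hy0
  have hx0 : x ≠ 0 := by
    rintro rfl
    rw [map_zero, zero_div] at hxy
    exact hb hxy.symm
  -- `a = x y`, `(a : K) = b y²`
  have ha : ((x * y : 𝓞 K) : K) = b * (y : K) ^ 2 := by
    rw [← hxy]; push_cast; field_simp
  have hval' : ∀ v : HeightOneSpectrum (𝓞 K), D ∉ v.asIdeal →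
      (2 : ℤ) ∣ WithZero.log (v.valuation K ((x * y : 𝓞 K) : K)) := by
    intro v hv
    rw [ha]
    refine (two_dvd_log_valuation_mul_iff v hb (pow_ne_zero 2 hy0') ?_).mpr (hval v hv)
    rw [map_pow, WithZero.log_pow]
    exact ⟨_, by rw [two_nsmul, two_mul]⟩
  obtain ⟨u, l, hlG, hnd, w, hw⟩ := exists_isSquare_mul_of_two_dvd_log_valuation_int D G hD
    (x * y) (mul_ne_zero hx0 hy0) hval'
  refine ⟨u, l, hlG, hnd, w / y, ?_⟩
  rw [ha] at hw
  field_simp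
  linear_combination hw

end Literature.NumberTheory.NumberFields
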